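/-
HONEST FRAMING: certified error envelopes and provably optimal rounding/accumulation schemes for
low-precision formats under stated cost models; every table by two implementations; no hardware
or vendor claims.
-/
import Summits.Ventures.CertifiedArithmetic.LowPrec.OptDemotionLines

/-!
# The demotion law (Theorem T8), part 6a: the FULL line family and the coupled polynomial

OPTIMA.md §B T8(b)(iii″) (opt seat, gen 11) reorganises the line-family proof of Conjecture D
(`D_t = Q_t` for every summation tree accumulated in a wide format `F_q` and demoted once to `F_p`)
around the UNFILTERED line family `L_t` — the family `goodLines` of part 5 without its goodness
filter on the transposing transforms — and proves on paper:

* (R7) FULL FAMILY = COUPLED POLYNOMIAL: for every real `ρ > 0`,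
  `G_t(ρ) := max_{(α,λ) ∈ L_t} (α + λρ) = Q_t^(ρ) - 1 - ρ`, where `Q_t^(ρ) = treeQf u t ρ` is opt's
  coupled recursion with `u_p` replaced by `ρ`;
* (R8) the root (demotion) step holds for every tree;
so that Conjecture D beyond `M_t(u_q) ≤ 2` is EXACTLY a node-step statement.

THIS FILE is (R7) and the structural facts of `L_t`:
* `allLines u t` — the full family (`F1 ∪ F2 ∪ F3 ∪ F4`, no filter); `goodLines ⊆ allLines`
  (`goodLines_subset_allLines`), the μ-line is a member (`mu_mem_allLines`), every member has
  `0 ≤ α ≤ μ_t`, `0 ≤ λ ≤ μ_t` (`allLines_bounds`);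
* `allLine_le_treeQf` — every line lies below the coupled polynomial: `1 + ρ + α + λρ ≤ treeQf u t ρ`;
* `exists_allLine_eq_treeQf` — and the envelope is ATTAINED: some line has
  `1 + ρ + α + λρ = treeQf u t ρ` (`ρ > 0`) — together (R7): `1 + ρ + G_t(ρ) = Q_t^(ρ)`;
* `treeQf_zero` — `treeQf u t 0 = treeM u t` (with Lean's `u/0 = 0` the family is the tree
  polynomial at `ρ = 0`, so `σ · treeQf u t x` is a cap for EVERY excess `x ∈ [0,1)`);
* `GoodActive q` — OPT's GOOD-ACTIVE lemma (OPTIMA (iii″)(R9)(2)) as a named `Prop`: at every grid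
  excess `x = 2k·u_q < 1` every line of `L_t` is dominated AT `x` by a line with `λ ≤ α`.  Parts
  6b–6d prove `GoodActive q` ⟹ Conjecture D at `q`.  STATUS (corrected 2026-08-21, referee
  RETURN-26 / NIT-32): **GOOD-ACTIVE IS FALSE ON THE GRID** — part 6e (`OptDemotionGoodActiveCex`,
  `not_goodActive_five`) refutes it at `q = 5` with the 43-leaf tree `gaCex43` at `x = 15/16`
  (`decide +kernel`), and opt gen 11 (OPTIMA (R9)(2a), `gen11/gafail_q4.txt`) exhibits a 37-leaf
  tree failing at `q = 4`, `x = 7/8` (unique active line `(169/256, 91/128)`, `λ > α`); opt's earlier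
  "0 exceptions in 73 280 grid evaluations" did not reach these shapes.  So the implication of parts
  6b–6d is VACUOUS as a route to ALL trees at `q = 4, 5`; what it still yields unconditionally is
  part 6d's class theorem (every class closed under children on which `GoodActiveTree` holds, e.g.
  all `u_q`-balanced trees and every perfect tree).  NOTHING for `M_t > 2` may be claimed from
  parts 6b–6d alone.
-/

namespace Summit.Ventures.CertifiedArithmetic.LowPrec.Opt

open Literature.ComputerArithmetic.JeannerodRump2018
open Literature.ComputerArithmetic.JeannerodRump2018.SumTree

/-! ## The full family -/

/-- The FULL line family `L_t` of OPTIMA T8(b)(iii″)(R7): leaf `{(0,0)}`; at a node `a·b` the four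
transforms `F1(α,λ) = (α + u + uμ_b, λ)` (lines of `a`), `F2` (symmetric),
`F3(α,λ) = (u + μ_a + uλ, α)` (lines of `b`, transposed, NO goodness filter), `F4` (symmetric). -/
def allLines (u : ℚ) : SumTree → List (ℚ × ℚ)
  | .leaf _ => [(0, 0)]
  | .node a b =>
      (allLines u a).map (fun l => (l.1 + u + u * (treeM u b - 1), l.2)) ++
      (allLines u b).map (fun l => (l.1 + u + u * (treeM u a - 1), l.2)) ++
      (allLines u b).map (fun l => (u + (treeM u a - 1) + u * l.2, l.1)) ++
      (allLines u a).map (fun l => (u + (treeM u b - 1) + u * l.2, l.1))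

/-- The leaf has the single line `(0,0)`. -/
@[simp] theorem allLines_leaf (u x : ℚ) : allLines u (.leaf x) = [(0, 0)] := rfl

/-- `F1`: a line of `a` shifted by `u·M_b` is a line of `a·b`. -/
theorem mem_allLines_F1 {u : ℚ} {a b : SumTree} {α lam : ℚ} (h : (α, lam) ∈ allLines u a) :
    (α + u + u * (treeM u b - 1), lam) ∈ allLines u (.node a b) := by
  simp only [allLines, List.mem_append, List.mem_map]
  exact Or.inl (Or.inl (Or.inl ⟨(α, lam), h, rfl⟩))

/-- `F2`: a line of `b` shifted by `u·M_a` is a line of `a·b`. -/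
theorem mem_allLines_F2 {u : ℚ} {a b : SumTree} {α lam : ℚ} (h : (α, lam) ∈ allLines u b) :
    (α + u + u * (treeM u a - 1), lam) ∈ allLines u (.node a b) := by
  simp only [allLines, List.mem_append, List.mem_map]
  exact Or.inl (Or.inl (Or.inr ⟨(α, lam), h, rfl⟩))

/-- `F3`: the transpose of ANY line of `b` is a line of `a·b`. -/
theorem mem_allLines_F3 {u : ℚ} {a b : SumTree} {α lam : ℚ} (h : (α, lam) ∈ allLines u b) :
    (u + (treeM u a - 1) + u * lam, α) ∈ allLines u (.node a b) := by
  simp only [allLines, List.mem_append, List.mem_map]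
  exact Or.inl (Or.inr ⟨(α, lam), h, rfl⟩)

/-- `F4`: the transpose of ANY line of `a` is a line of `a·b`. -/
theorem mem_allLines_F4 {u : ℚ} {a b : SumTree} {α lam : ℚ} (h : (α, lam) ∈ allLines u a) :
    (u + (treeM u b - 1) + u * lam, α) ∈ allLines u (.node a b) := by
  simp only [allLines, List.mem_append, List.mem_map]
  exact Or.inr ⟨(α, lam), h, rfl⟩

/-- Case analysis on membership in the full family of a node. -/
theorem mem_allLines_node {u : ℚ} {a b : SumTree} {l : ℚ × ℚ} (h : l ∈ allLines u (.node a b)) :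
    (∃ m ∈ allLines u a, l = (m.1 + u + u * (treeM u b - 1), m.2)) ∨
    (∃ m ∈ allLines u b, l = (m.1 + u + u * (treeM u a - 1), m.2)) ∨
    (∃ m ∈ allLines u b, l = (u + (treeM u a - 1) + u * m.2, m.1)) ∨
    (∃ m ∈ allLines u a, l = (u + (treeM u b - 1) + u * m.2, m.1)) := by
  simp only [allLines, List.mem_append, List.mem_map] at h
  rcases h with ((⟨m, hm, rfl⟩ | ⟨m, hm, rfl⟩) | ⟨m, hm, rfl⟩) | ⟨m, hm, rfl⟩
  · exact Or.inl ⟨m, hm, rfl⟩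
  · exact Or.inr (Or.inl ⟨m, hm, rfl⟩)
  · exact Or.inr (Or.inr (Or.inl ⟨m, hm, rfl⟩))
  · exact Or.inr (Or.inr (Or.inr ⟨m, hm, rfl⟩))

/-- The hereditary-good family of part 5 is a sub-family. -/
theorem goodLines_subset_allLines (u : ℚ) :
    ∀ (t : SumTree) (l : ℚ × ℚ), l ∈ goodLines u t → l ∈ allLines u t
  | .leaf x, l, h => by simpa using h
  | .node a b, l, h => by
      rcases mem_goodLines_node h with ⟨m, hm, rfl⟩ | ⟨m, hm, rfl⟩ | ⟨m, hm, -, rfl⟩ | ⟨m, hm, -, rfl⟩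
      · exact mem_allLines_F1 (goodLines_subset_allLines u a _ hm)
      · exact mem_allLines_F2 (goodLines_subset_allLines u b _ hm)
      · exact mem_allLines_F3 (goodLines_subset_allLines u b _ hm)
      · exact mem_allLines_F4 (goodLines_subset_allLines u a _ hm)

/-- THE μ-LINE `(M_t - 1, 0)` is a member of the full family. -/
theorem mu_mem_allLines {u : ℚ} (hu0 : 0 ≤ u) (hu1 : u ≤ 1) (t : SumTree) :
    (treeM u t - 1, 0) ∈ allLines u t :=
  goodLines_subset_allLines u t _ (mu_mem_goodLines hu0 hu1 t)

/-- Every line of the full family satisfies `0 ≤ λ ≤ μ_t` and `0 ≤ α ≤ μ_t` (`0 ≤ u ≤ 1`); the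
goodness `λ ≤ α` of part 5 is NOT available in general. -/
theorem allLines_bounds {u : ℚ} (hu0 : 0 ≤ u) (hu1 : u ≤ 1) :
    ∀ (t : SumTree) (l : ℚ × ℚ), l ∈ allLines u t →
      0 ≤ l.2 ∧ l.2 ≤ treeM u t - 1 ∧ 0 ≤ l.1 ∧ l.1 ≤ treeM u t - 1
  | .leaf x, l, h => by
      simp only [allLines_leaf, List.mem_singleton] at h
      subst h; simp
  | .node a b, l, h => by
      have hMa := one_le_treeM hu0 a
      have hMb := one_le_treeM hu0 b
      have hN := treeM_node_sub_one_ge hu0 hu1 a b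
      have hC : treeM u a ≤ treeM u (.node a b) ∧ treeM u b ≤ treeM u (.node a b) := by
        constructor
        · nlinarith [hN.1, mul_nonneg hu0 (by linarith : (0:ℚ) ≤ treeM u b - 1)]
        · nlinarith [hN.2, mul_nonneg hu0 (by linarith : (0:ℚ) ≤ treeM u a - 1)]
      rcases mem_allLines_node h with ⟨m, hm, rfl⟩ | ⟨m, hm, rfl⟩ | ⟨m, hm, rfl⟩ | ⟨m, hm, rfl⟩
      · obtain ⟨h0, h1, h2, h3⟩ := allLines_bounds hu0 hu1 a m hm
        refine ⟨h0, by dsimp only; linarith [hC.1], ?_, by dsimp only; linarith [hN.1]⟩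
        dsimp only; nlinarith [mul_nonneg hu0 (by linarith : (0:ℚ) ≤ treeM u b - 1)]
      · obtain ⟨h0, h1, h2, h3⟩ := allLines_bounds hu0 hu1 b m hm
        refine ⟨h0, by dsimp only; linarith [hC.2], ?_, by dsimp only; linarith [hN.2]⟩
        dsimp only; nlinarith [mul_nonneg hu0 (by linarith : (0:ℚ) ≤ treeM u a - 1)]
      · obtain ⟨h0, h1, h2, h3⟩ := allLines_bounds hu0 hu1 b m hm
        refine ⟨h2, by dsimp only; linarith [hC.2], ?_, ?_⟩
        · dsimp only; nlinarith [mul_nonneg hu0 h0]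
        · dsimp only
          have : u * m.2 ≤ u * (treeM u b - 1) := mul_le_mul_of_nonneg_left h1 hu0
          linarith [hN.1]
      · obtain ⟨h0, h1, h2, h3⟩ := allLines_bounds hu0 hu1 a m hm
        refine ⟨h2, by dsimp only; linarith [hC.1], ?_, ?_⟩
        · dsimp only; nlinarith [mul_nonneg hu0 h0]
        · dsimp only
          have : u * m.2 ≤ u * (treeM u a - 1) := mul_le_mul_of_nonneg_left h1 hu0
          linarith [hN.2]

/-! ## (R7) The envelope of the full family is the coupled polynomial -/

/-- EVERY LINE OF THE FULL FAMILY IS BELOW `Q_t^(ρ)`: `1 + ρ + α + λρ ≤ treeQf u t ρ` for every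
`ρ > 0` (`u > 0`); for `F3`/`F4` the inner value is read at the transposed ratio `u/ρ`. -/
theorem allLine_le_treeQf {u : ℚ} (hu : 0 < u) :
    ∀ (t : SumTree) (l : ℚ × ℚ), l ∈ allLines u t → ∀ ρ : ℚ, 0 < ρ →
      1 + ρ + l.1 + l.2 * ρ ≤ treeQf u t ρ
  | .leaf x, l, h, ρ, _ => by
      simp only [allLines_leaf, List.mem_singleton] at h
      subst h; simp
  | .node a b, l, h, ρ, hρ => by
      rw [treeQf_node]
      rcases mem_allLines_node h with ⟨m, hm, rfl⟩ | ⟨m, hm, rfl⟩ | ⟨m, hm, rfl⟩ | ⟨m, hm, rfl⟩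
      · have ih := allLine_le_treeQf hu a m hm ρ hρ
        have : 1 + ρ + (m.1 + u + u * (treeM u b - 1)) + m.2 * ρ ≤ treeQf u a ρ + u * treeM u b := by
          linarith
        exact this.trans ((le_max_left _ _).trans (le_max_left _ _))
      · have ih := allLine_le_treeQf hu b m hm ρ hρ
        have : 1 + ρ + (m.1 + u + u * (treeM u a - 1)) + m.2 * ρ ≤ treeQf u b ρ + u * treeM u a := by
          linarith
        exact this.trans ((le_max_right _ _).trans (le_max_left _ _))
      · have ih := allLine_le_treeQf hu b m hm (u / ρ) (div_pos hu hρ)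
        have h2 := mul_le_mul_of_nonneg_left ih hρ.le
        have e : ρ * (1 + u / ρ + m.1 + m.2 * (u / ρ)) = ρ + u + m.1 * ρ + u * m.2 := by
          field_simp
        have key : 1 + ρ + (u + (treeM u a - 1) + u * m.2) + m.1 * ρ
            ≤ treeM u a + ρ * treeQf u b (u / ρ) := by linarith [e ▸ h2]
        exact key.trans ((le_max_left _ _).trans (le_max_right _ _))
      · have ih := allLine_le_treeQf hu a m hm (u / ρ) (div_pos hu hρ)
        have h2 := mul_le_mul_of_nonneg_left ih hρ.le
        have e : ρ * (1 + u / ρ + m.1 + m.2 * (u / ρ)) = ρ + u + m.1 * ρ + u * m.2 := by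
          field_simp
        have key : 1 + ρ + (u + (treeM u b - 1) + u * m.2) + m.1 * ρ
            ≤ treeM u b + ρ * treeQf u a (u / ρ) := by linarith [e ▸ h2]
        exact key.trans ((le_max_right _ _).trans (le_max_right _ _))

/-- **(R7) THE ENVELOPE IS ATTAINED**: for every `ρ > 0` some line of the full family has
`1 + ρ + α + λρ = treeQf u t ρ`.  With `allLine_le_treeQf`: `1 + ρ + G_t(ρ) = Q_t^(ρ)` — the full
family IS opt's coupled recursion read at a real parameter (the four groups of lines are the four
options of the recursion; a transposed group is the inner envelope at `u/ρ`, scaled by `ρ`). -/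
theorem exists_allLine_eq_treeQf {u : ℚ} (hu : 0 < u) :
    ∀ (t : SumTree) (ρ : ℚ), 0 < ρ →
      ∃ l ∈ allLines u t, 1 + ρ + l.1 + l.2 * ρ = treeQf u t ρ
  | .leaf x, ρ, _ => ⟨(0, 0), by simp, by simp⟩
  | .node a b, ρ, hρ => by
      rw [treeQf_node]
      rcases max_choice (max (treeQf u a ρ + u * treeM u b) (treeQf u b ρ + u * treeM u a))
          (max (treeM u a + ρ * treeQf u b (u / ρ)) (treeM u b + ρ * treeQf u a (u / ρ))) with h | h
        <;> rw [h]
      · rcases max_choice (treeQf u a ρ + u * treeM u b) (treeQf u b ρ + u * treeM u a) with h' | h'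
          <;> rw [h']
        · obtain ⟨m, hm, he⟩ := exists_allLine_eq_treeQf hu a ρ hρ
          exact ⟨_, mem_allLines_F1 (b := b) hm, by dsimp only; linarith⟩
        · obtain ⟨m, hm, he⟩ := exists_allLine_eq_treeQf hu b ρ hρ
          exact ⟨_, mem_allLines_F2 (a := a) hm, by dsimp only; linarith⟩
      · rcases max_choice (treeM u a + ρ * treeQf u b (u / ρ)) (treeM u b + ρ * treeQf u a (u / ρ))
          with h' | h' <;> rw [h']
        · obtain ⟨m, hm, he⟩ := exists_allLine_eq_treeQf hu b (u / ρ) (div_pos hu hρ)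
          refine ⟨_, mem_allLines_F3 (a := a) hm, ?_⟩
          dsimp only
          have e : ρ * (1 + u / ρ + m.1 + m.2 * (u / ρ)) = ρ + u + m.1 * ρ + u * m.2 := by
            field_simp
          have h2 : ρ * (1 + u / ρ + m.1 + m.2 * (u / ρ)) = ρ * treeQf u b (u / ρ) := by rw [he]
          linarith
        · obtain ⟨m, hm, he⟩ := exists_allLine_eq_treeQf hu a (u / ρ) (div_pos hu hρ)
          refine ⟨_, mem_allLines_F4 (b := b) hm, ?_⟩
          dsimp only
          have e : ρ * (1 + u / ρ + m.1 + m.2 * (u / ρ)) = ρ + u + m.1 * ρ + u * m.2 := by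
            field_simp
          have h2 : ρ * (1 + u / ρ + m.1 + m.2 * (u / ρ)) = ρ * treeQf u a (u / ρ) := by rw [he]
          linarith

/-- (R7) packaged: the envelope `G_t(ρ)` of the full family, read through any maximising line, is
`treeQf u t ρ - 1 - ρ`: every line is below, one line attains. -/
theorem treeQf_eq_envelope {u : ℚ} (hu : 0 < u) (t : SumTree) {ρ : ℚ} (hρ : 0 < ρ) :
    (∀ l ∈ allLines u t, 1 + ρ + l.1 + l.2 * ρ ≤ treeQf u t ρ) ∧
    (∃ l ∈ allLines u t, 1 + ρ + l.1 + l.2 * ρ = treeQf u t ρ) :=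
  ⟨fun l hl => allLine_le_treeQf hu t l hl ρ hρ, exists_allLine_eq_treeQf hu t ρ hρ⟩

/-! ## The value at `ρ = 0` -/

/-- `treeQf u t 0 = treeM u t` (`0 ≤ u ≤ 1`): with Lean's convention `u / 0 = 0` the transposed
options degenerate to `M_a`, `M_b` and the recursion returns `max(M_a + uM_b, M_b + uM_a) = M_t`.
Consequently `σ · treeQf u t x` is ONE cap for every excess `x ∈ [0, 1)`, the binade point
`x = 0` included. -/
theorem treeQf_zero {u : ℚ} (hu0 : 0 ≤ u) (hu1 : u ≤ 1) : ∀ t : SumTree, treeQf u t 0 = treeM u t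
  | .leaf x => by simp
  | .node a b => by
      have ha := treeQf_zero hu0 hu1 a
      have hb := treeQf_zero hu0 hu1 b
      have hMa := one_le_treeM hu0 a
      have hMb := one_le_treeM hu0 b
      rw [treeQf_node, div_zero, zero_mul, zero_mul, add_zero, add_zero, ha, hb, treeM_node]
      rcases le_total (treeM u b) (treeM u a) with hle | hle
      · have h1 : treeM u b + u * treeM u a ≤ treeM u a + u * treeM u b := by
          nlinarith [mul_nonneg (sub_nonneg.2 hu1) (sub_nonneg.2 hle)]
        have h2 : treeM u a ≤ treeM u a + u * treeM u b := by
          nlinarith [mul_nonneg hu0 (by linarith : (0:ℚ) ≤ treeM u b)]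
        rw [max_eq_left hle, min_eq_right hle, max_eq_left h1, max_eq_left h2]
      · have h1 : treeM u a + u * treeM u b ≤ treeM u b + u * treeM u a := by
          nlinarith [mul_nonneg (sub_nonneg.2 hu1) (sub_nonneg.2 hle)]
        have h2 : treeM u b ≤ treeM u b + u * treeM u a := by
          nlinarith [mul_nonneg hu0 (by linarith : (0:ℚ) ≤ treeM u a)]
        rw [max_eq_right hle, min_eq_left hle, max_eq_right h1, max_eq_left h2]

/-- The cap at a general excess: every line of the full family satisfies
`1 + x + α + λx ≤ treeQf u t x` for ALL `x ≥ 0` (`0 < u ≤ 1`; at `x = 0` by `treeQf_zero`). -/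
theorem allLine_le_treeQf_of_nonneg {u : ℚ} (hu : 0 < u) (hu1 : u ≤ 1) (t : SumTree)
    {l : ℚ × ℚ} (hl : l ∈ allLines u t) {x : ℚ} (hx : 0 ≤ x) :
    1 + x + l.1 + l.2 * x ≤ treeQf u t x := by
  rcases eq_or_lt_of_le hx with h0 | hpos
  · rw [← h0, treeQf_zero hu.le hu1 t]
    have := (allLines_bounds hu.le hu1 t l hl).2.2.2
    simp; linarith
  · exact allLine_le_treeQf hu t l hl x hpos

/-! ## GOOD-ACTIVE as a named statement -/

/-- **GOOD-ACTIVE** (OPT gen 11, OPTIMA §B T8(b)(iii″)(R9)(2)), precision `q`: for every summation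
tree `t` and every GRID excess `x = 2k·u_q < 1` (the excesses `v/ufp(v) - 1` of the floats of `F_q`),
every line of the full family `L_t` is dominated AT `x` by a GOOD line (slope at most intercept) of
`L_t` — equivalently the envelope `G_t(x)` is attained by a good line.  Parts 6b–6d prove:
`GoodActive q` ⟹ Conjecture D (`D_t ≤ Q_t`) for EVERY tree at `q`, every `p`.
**THE HYPOTHESIS IS FALSE** (correction recorded 2026-08-21, referee RETURN-26 / NIT-32): part 6e
(`OptDemotionGoodActiveCex.not_goodActive_five`) gives `¬ GoodActive 5` by the 43-leaf tree `gaCex43`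
at the grid excess `x = 15/16` (kernel-checked), and opt gen 11's 37-leaf tree (`gafail_q4.txt`)
fails at `q = 4`, `x = 7/8`; opt's earlier count "0 exceptions in 73 280 grid evaluations over
11 241 node shapes" simply did not contain such shapes (all known failures sit at the top grid point
`x = 1 - 2u` of a binade).  Use the per-tree form `GoodActiveTree` (part 6d) as a CLASS hypothesis;
the global `GoodActive q` is kept only as the name of the refuted statement. -/
def GoodActive (q : ℕ) : Prop :=
  ∀ (t : SumTree) (k : ℕ), (k : ℚ) * (2 * unitRoundoff q) < 1 →
    ∀ l ∈ allLines (unitRoundoff q) t, ∃ l' ∈ allLines (unitRoundoff q) t,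
      l'.2 ≤ l'.1 ∧
      l.1 + l.2 * ((k : ℚ) * (2 * unitRoundoff q)) ≤ l'.1 + l'.2 * ((k : ℚ) * (2 * unitRoundoff q))

/-- GOOD-ACTIVE holds trivially at the binade point `x = 0` (the μ-line dominates every line). -/
theorem goodActive_zero (q : ℕ) (t : SumTree) (l : ℚ × ℚ)
    (hl : l ∈ allLines (unitRoundoff q) t) :
    ∃ l' ∈ allLines (unitRoundoff q) t, l'.2 ≤ l'.1 ∧
      l.1 + l.2 * ((0 : ℚ) * (2 * unitRoundoff q)) ≤ l'.1 + l'.2 * ((0 : ℚ) * (2 * unitRoundoff q)) := by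
  have hu0 := unitRoundoff_nonneg q
  have hu1 := unitRoundoff_le_one q
  refine ⟨_, mu_mem_allLines hu0 hu1 t, ?_, ?_⟩
  · have := one_le_treeM hu0 t; simp; linarith
  · have := (allLines_bounds hu0 hu1 t l hl).2.2.2; simp; linarith

end Summit.Ventures.CertifiedArithmetic.LowPrec.Opt
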